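import Summits.CriticalPhenomena.PercolationContinuityZ3.Theorems.FK.EdgeDensityDerivative
import Summits.CriticalPhenomena.PercolationContinuityZ3.Theorems.SahiMasterFamilyStrictHarris
import HarnessLib

/-!
# Per-edge covariance bounds for tilted measures with one-edge finite energy (Grimmett 2006, Thm. (2.43)
# with eq. (2.45)): the margin-free derivative bound `|d/dp E_p[X]| ≤ (Λ_hi/Λ_lo) |F|`

Support file of the `fk-continuity` cell (FANOUT-PLAN.md row FO-09, follow-up; `--supports stmt-CriticalPhenomena-4575`);
builds on p205010 (kernel theorem, internal audit signed; external expert review pending).  Companion of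
`EdgeDensityDerivative.lean` (Russo's formula for tilted measures, `abs_tiltAvg_sub_tiltAvg_le` with the constant
`N / min{p(1-p), p'(1-p')}`, which degenerates at `p ∈ {0, 1}`) and the abstract half of `EdgeDensityLipschitz.lean`
(the random-cluster instances).

Grimmett 2006, §2.5: for a finite weight `μ ≥ 0` on `Ω = {0,1}^F` let `μ_p(ω) ∝ μ(ω) p^{|η(ω)|} (1-p)^{|F|-|η(ω)|}`
(eq. (2.42)).  Theorem (2.43): `d/dp μ_p(X) = cov_p(|η|, X)/(p(1-p))`, and (eq. (2.45)) `cov_p(|η|, X) = Σ_e cov_p(J_e, X)`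
with `J_e = 1_{e open}`.  Here the covariance is estimated EDGE BY EDGE: for `0 ≤ X ≤ 1`,
`|cov_p(J_e, X)| ≤ μ_p(J_e)(1 - μ_p(J_e))` (`abs_cov_indicator_le`), and if `μ` has the one-edge finite-energy property
`Λ_lo μ(ω) ≤ μ(ω ∪ {e}) ≤ Λ_hi μ(ω)` (`0 < Λ_lo ≤ 1 ≤ Λ_hi`; for the random-cluster weight `q^{k(ω)}`, `q ≥ 1`, one has
`Λ_hi = 1`, `Λ_lo = q⁻¹` — Grimmett 2006, Thm. (3.1) eq. (3.3): the conditional probability of an open edge given the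
rest is `p` or `p/(p + q(1-p))`), then the density `θ = μ_p(J_e)` obeys `θ ≤ Λ_hi p/(Λ_hi p + 1 - p)`,
`1 - θ ≤ (1-p)/(Λ_lo p + 1 - p)`, so `θ(1-θ) ≤ (Λ_hi/Λ_lo) p(1-p)` (`mul_le_of_flip`) and
`|d/dp μ_p(X)| ≤ (Λ_hi/Λ_lo) |F|` UNIFORMLY in `p ∈ (0, 1)` and in `μ`; by the mean value theorem
`|μ_{p'}(X) - μ_p(X)| ≤ (Λ_hi/Λ_lo) |F| |p' - p|` (`abs_tiltAvg_sub_tiltAvg_le_mul`).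

## Contents (all proved; no named facts)

* §1 finite weighted averages on `Set ι` (the pairing `ω ↔ ω ∪ {e}` is the tree's `sum_conf_split`,
  `SahiMasterFamilyStrictHarris.lean`): `cov_sum_left` (additivity of the covariance form, eq. (2.45)), `abs_cov_indicator_le` (`|cov_W(J_e, X)| ≤ S₀S₁/Z²`),
  `mul_le_of_flip` (`S₀ S₁ ≤ (Λ_hi/Λ_lo) r(1-r) (S₀ + S₁)²` under the summed flip inequalities),
  `abs_cov_indicator_le_of_flip`, `abs_cov_le_of_flip` (`|cov_W(|η ∩ F|, X)| ≤ |F| (Λ_hi/Λ_lo) r(1-r)`),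
  `exponent_insert` (`|(ω ∪ {e}) ∩ F| = |ω ∩ F| + 1`);
* §2 the tilted family `w_r = r^{a} (1-r)^{b} μ` (`a = |ω ∩ F|`, `a + b = |F|`): the flip inequalities `tilt_flip_le` /
  `le_tilt_flip` and the margin-free bound `abs_tiltAvg_sub_tiltAvg_le_mul`
  (`|E_{p'}[X] - E_p[X]| ≤ (Λ_hi/Λ_lo) |F| |p' - p|`, `p, p' ∈ (0, 1)`).

## References

* G. Grimmett, *The Random-Cluster Model*, Springer 2006: §2.5 eq. (2.42), Thm. (2.43) with eq. (2.44)–(2.47) (p. 40),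
  in particular eq. (2.45) `cov_p(|η|, X) = Σ_e cov_p(J_e, X)`; §3.1 Thm. (3.1) eq. (3.3)–(3.4) (pp. 43–44, conditional
  edge probabilities / finite energy); §3.3 Thm. (3.12) eq. (3.13) (p. 46). [Grimmett2006]
-/

noncomputable section

namespace Summit.CriticalPhenomena.PercolationContinuityZ3.Theorems

namespace FK

open MeasureTheory Finset
open scoped Topology

/-! ### §1 Finite weighted averages on `Set ι`: the per-edge covariance bound -/

section PerEdge

open scoped Classical

variable {ι : Type*} [Fintype ι]

/-- The covariance form `cov_W(Y, X) = E_W[Y X] - E_W[Y] E_W[X]` of a finite weighted average is additive in its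
first argument over a finite family `Y = Σ_{e ∈ F} g_e` (Grimmett 2006, eq. (2.45): `cov_p(|η|, X) = Σ_e cov_p(J_e, X)`).
[cite: Grimmett2006, Thm. (2.43) eq. (2.45) p. 40] -/
theorem cov_sum_left (F : Finset ι) (W X : Set ι → ℝ) (g : ι → Set ι → ℝ) :
    (∑ ω, W ω * ((∑ e ∈ F, g e ω) * X ω)) / (∑ ω, W ω) -
        (∑ ω, W ω * ∑ e ∈ F, g e ω) / (∑ ω, W ω) * ((∑ ω, W ω * X ω) / ∑ ω, W ω) =
      ∑ e ∈ F, ((∑ ω, W ω * (g e ω * X ω)) / (∑ ω, W ω) -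
        (∑ ω, W ω * g e ω) / (∑ ω, W ω) * ((∑ ω, W ω * X ω) / ∑ ω, W ω)) := by
  have e1 : ∑ ω, W ω * ((∑ e ∈ F, g e ω) * X ω) = ∑ e ∈ F, ∑ ω, W ω * (g e ω * X ω) := by
    rw [Finset.sum_comm]
    exact Finset.sum_congr rfl fun ω _ => by rw [Finset.sum_mul, Finset.mul_sum]
  have e2 : ∑ ω, W ω * ∑ e ∈ F, g e ω = ∑ e ∈ F, ∑ ω, W ω * g e ω := by
    rw [Finset.sum_comm]
    exact Finset.sum_congr rfl fun ω _ => by rw [Finset.mul_sum]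
  rw [e1, e2, Finset.sum_div, Finset.sum_div, Finset.sum_mul, ← Finset.sum_sub_distrib]

/-- **Per-edge covariance bound.**  For nonnegative weights `W` with positive total mass `Z = S₀ + S₁`
(`S₀ = Σ_{ω ∌ e} W(ω)`, `S₁ = Σ_{ω ∌ e} W(ω ∪ {e})`) and `0 ≤ X ≤ 1`:
`|cov_W(J_e, X)| = |A₁ S₀ - S₁ A₀| / Z² ≤ S₀ S₁ / Z²` (`= θ_e (1 - θ_e)`, `θ_e = E_W[J_e]`), where
`0 ≤ A₁ = Σ_{ω ∌ e} W(ω ∪ {e}) X(ω ∪ {e}) ≤ S₁` and `0 ≤ A₀ = Σ_{ω ∌ e} W(ω) X(ω) ≤ S₀`. [folklore] -/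
theorem abs_cov_indicator_le (e : ι) {W X : Set ι → ℝ} (hW : ∀ ω, 0 ≤ W ω) (hZ : 0 < ∑ ω, W ω)
    (hX : ∀ ω, 0 ≤ X ω ∧ X ω ≤ 1) :
    |(∑ ω, W ω * ((if e ∈ ω then (1 : ℝ) else 0) * X ω)) / (∑ ω, W ω) -
        (∑ ω, W ω * (if e ∈ ω then (1 : ℝ) else 0)) / (∑ ω, W ω) * ((∑ ω, W ω * X ω) / ∑ ω, W ω)| ≤
      (∑ ω ∈ univ.filter (fun ω : Set ι => e ∉ ω), W ω) *
        (∑ ω ∈ univ.filter (fun ω : Set ι => e ∉ ω), W (insert e ω)) / (∑ ω, W ω) ^ 2 := by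
  set s := univ.filter (fun ω : Set ι => e ∉ ω) with hs
  set S0 := ∑ ω ∈ s, W ω with hS0
  set S1 := ∑ ω ∈ s, W (insert e ω) with hS1
  set A0 := ∑ ω ∈ s, W ω * X ω with hA0
  set A1 := ∑ ω ∈ s, W (insert e ω) * X (insert e ω) with hA1
  have hmem : ∀ ω ∈ s, e ∉ ω := fun ω hω => (Finset.mem_filter.1 hω).2
  -- the four sums in the covariance form
  have hZ' : ∑ ω, W ω = S0 + S1 := by
    rw [sum_conf_split e W, Finset.sum_add_distrib]
  have h1 : ∑ ω, W ω * ((if e ∈ ω then (1 : ℝ) else 0) * X ω) = A1 := by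
    rw [sum_conf_split e]
    refine Finset.sum_congr rfl fun ω hω => ?_
    rw [if_neg (hmem ω hω), if_pos (Set.mem_insert e ω)]
    ring
  have h2 : ∑ ω, W ω * (if e ∈ ω then (1 : ℝ) else 0) = S1 := by
    rw [sum_conf_split e]
    refine Finset.sum_congr rfl fun ω hω => ?_
    rw [if_neg (hmem ω hω), if_pos (Set.mem_insert e ω)]
    ring
  have h3 : ∑ ω, W ω * X ω = A0 + A1 := by
    rw [sum_conf_split e, Finset.sum_add_distrib]
  rw [h1, h2, h3, hZ']
  -- bounds on the pieces
  have hS0 : 0 ≤ S0 := Finset.sum_nonneg fun ω _ => hW ω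
  have hS1 : 0 ≤ S1 := Finset.sum_nonneg fun ω _ => hW _
  have hA0 : 0 ≤ A0 := Finset.sum_nonneg fun ω _ => mul_nonneg (hW ω) (hX ω).1
  have hA1 : 0 ≤ A1 := Finset.sum_nonneg fun ω _ => mul_nonneg (hW _) (hX _).1
  have hA0' : A0 ≤ S0 := Finset.sum_le_sum fun ω _ => mul_le_of_le_one_right (hW ω) (hX ω).2
  have hA1' : A1 ≤ S1 := Finset.sum_le_sum fun ω _ => mul_le_of_le_one_right (hW _) (hX _).2
  have hZ0 : 0 < S0 + S1 := by rw [← hZ']; exact hZ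
  have hZne : S0 + S1 ≠ 0 := hZ0.ne'
  have key : A1 / (S0 + S1) - S1 / (S0 + S1) * ((A0 + A1) / (S0 + S1)) =
      (A1 * S0 - S1 * A0) / (S0 + S1) ^ 2 := by
    field_simp
    ring
  rw [key, abs_div, abs_of_pos (pow_pos hZ0 2)]
  refine div_le_div_of_nonneg_right ?_ (pow_pos hZ0 2).le
  rw [abs_le]
  constructor
  · nlinarith [mul_le_mul_of_nonneg_left hA0' hS1]
  · nlinarith [mul_le_mul_of_nonneg_left hA1' hS0]

/-- **The flip inequalities bound `θ(1-θ)`.**  If `(1-r) S₁ ≤ Λ_hi r S₀` and `Λ_lo r S₀ ≤ (1-r) S₁` with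
`0 < Λ_lo ≤ 1 ≤ Λ_hi`, `r ∈ [0, 1]`, `S₀, S₁ ≥ 0`, then `S₀ S₁ ≤ (Λ_hi/Λ_lo) r(1-r) (S₀ + S₁)²`: the density
`θ = S₁/(S₀ + S₁)` satisfies `θ ≤ Λ_hi r/(Λ_hi r + 1 - r)` and `1 - θ ≤ (1-r)/(Λ_lo r + 1 - r)`, and
`Λ_hi r + 1 - r ≥ 1`, `Λ_lo r + 1 - r ≥ Λ_lo`. [folklore] -/
theorem mul_le_of_flip {S0 S1 Λlo Λhi r : ℝ} (hS0 : 0 ≤ S0) (hS1 : 0 ≤ S1) (hlo : 0 < Λlo) (hlo1 : Λlo ≤ 1)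
    (hhi : 1 ≤ Λhi) (hr : r ∈ Set.Icc (0 : ℝ) 1) (h1 : (1 - r) * S1 ≤ Λhi * r * S0)
    (h2 : Λlo * r * S0 ≤ (1 - r) * S1) :
    S0 * S1 ≤ Λhi / Λlo * (r * (1 - r)) * (S0 + S1) ^ 2 := by
  have hr0 : 0 ≤ r := hr.1
  have hr1 : 0 ≤ 1 - r := sub_nonneg.2 hr.2
  rw [div_mul_eq_mul_div, div_mul_eq_mul_div, le_div_iff₀ hlo]
  -- (i) `(1-r)² S₀ S₁ ≤ Λ_hi r (1-r) S₀²`, (ii) `Λ_hi Λ_lo r² S₀ S₁ ≤ Λ_hi r (1-r) S₁²`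
  have hi : (1 - r) * ((1 - r) * S1) * S0 ≤ (1 - r) * (Λhi * r * S0) * S0 :=
    mul_le_mul_of_nonneg_right (mul_le_mul_of_nonneg_left h1 hr1) hS0
  have hii : Λhi * r * (Λlo * r * S0) * S1 ≤ Λhi * r * ((1 - r) * S1) * S1 :=
    mul_le_mul_of_nonneg_right (mul_le_mul_of_nonneg_left h2 (mul_nonneg (zero_le_one.trans hhi) hr0)) hS1
  -- (iii) the three term-wise comparisons with `Λ_lo (1-r)², 2 Λ_lo r(1-r), Λ_lo r²`
  have hSS : 0 ≤ S0 * S1 := mul_nonneg hS0 hS1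
  have hiii : Λlo * ((1 - r) ^ 2) ≤ (1 - r) ^ 2 := mul_le_of_le_one_left (sq_nonneg _) hlo1
  have hiv : Λlo * (r * (1 - r)) ≤ Λhi * (r * (1 - r)) :=
    mul_le_mul_of_nonneg_right (hlo1.trans hhi) (mul_nonneg hr0 hr1)
  have hv : Λlo * r ^ 2 ≤ Λhi * Λlo * r ^ 2 := by
    have : Λlo * r ^ 2 = 1 * (Λlo * r ^ 2) := (one_mul _).symm
    rw [this, mul_assoc]
    exact mul_le_mul_of_nonneg_right hhi (mul_nonneg hlo.le (sq_nonneg r))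
  nlinarith [mul_le_mul_of_nonneg_right hiii hSS, mul_le_mul_of_nonneg_right hiv hSS,
    mul_le_mul_of_nonneg_right hv hSS]

/-- **Per-edge covariance bound under one-edge finite energy.**  If the nonnegative weights `W` (positive total mass)
satisfy the flip inequalities `(1-r) W(ω ∪ {e}) ≤ Λ_hi r W(ω)` and `Λ_lo r W(ω) ≤ (1-r) W(ω ∪ {e})` for every `ω ∌ e`
(`0 < Λ_lo ≤ 1 ≤ Λ_hi`, `r ∈ [0, 1]`), then `|cov_W(J_e, X)| ≤ (Λ_hi/Λ_lo) r(1-r)` for every `0 ≤ X ≤ 1`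
(Grimmett 2006, Thm. (3.1) eq. (3.3): for the random-cluster weight the conditional edge density given the rest lies
between `p/(p + q(1-p))` and `p`). [cite: Grimmett2006, Thm. (3.1) eq. (3.3)–(3.4) pp. 43–44] -/
theorem abs_cov_indicator_le_of_flip (e : ι) {W X : Set ι → ℝ} {Λlo Λhi r : ℝ} (hW : ∀ ω, 0 ≤ W ω)
    (hZ : 0 < ∑ ω, W ω) (hX : ∀ ω, 0 ≤ X ω ∧ X ω ≤ 1) (hlo : 0 < Λlo) (hlo1 : Λlo ≤ 1) (hhi : 1 ≤ Λhi)
    (hr : r ∈ Set.Icc (0 : ℝ) 1) (h1 : ∀ ω : Set ι, e ∉ ω → (1 - r) * W (insert e ω) ≤ Λhi * r * W ω)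
    (h2 : ∀ ω : Set ι, e ∉ ω → Λlo * r * W ω ≤ (1 - r) * W (insert e ω)) :
    |(∑ ω, W ω * ((if e ∈ ω then (1 : ℝ) else 0) * X ω)) / (∑ ω, W ω) -
        (∑ ω, W ω * (if e ∈ ω then (1 : ℝ) else 0)) / (∑ ω, W ω) * ((∑ ω, W ω * X ω) / ∑ ω, W ω)| ≤
      Λhi / Λlo * (r * (1 - r)) := by
  refine (abs_cov_indicator_le e hW hZ hX).trans ?_
  set s := univ.filter (fun ω : Set ι => e ∉ ω) with hs
  have hmem : ∀ ω ∈ s, e ∉ ω := fun ω hω => (Finset.mem_filter.1 hω).2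
  have hZ' : ∑ ω, W ω = (∑ ω ∈ s, W ω) + ∑ ω ∈ s, W (insert e ω) := by
    rw [sum_conf_split e W, Finset.sum_add_distrib]
  have hS0 : 0 ≤ ∑ ω ∈ s, W ω := Finset.sum_nonneg fun ω _ => hW ω
  have hS1 : 0 ≤ ∑ ω ∈ s, W (insert e ω) := Finset.sum_nonneg fun ω _ => hW _
  -- the summed flip inequalities
  have H1 : (1 - r) * ∑ ω ∈ s, W (insert e ω) ≤ Λhi * r * ∑ ω ∈ s, W ω := by
    rw [Finset.mul_sum, Finset.mul_sum]
    exact Finset.sum_le_sum fun ω hω => h1 ω (hmem ω hω)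
  have H2 : Λlo * r * ∑ ω ∈ s, W ω ≤ (1 - r) * ∑ ω ∈ s, W (insert e ω) := by
    rw [Finset.mul_sum, Finset.mul_sum]
    exact Finset.sum_le_sum fun ω hω => h2 ω (hmem ω hω)
  have key := mul_le_of_flip hS0 hS1 hlo hlo1 hhi hr H1 H2
  rw [hZ', div_le_iff₀ (by rw [← hZ']; exact pow_pos hZ 2)]
  exact key

/-- **Covariance with the number of open edges of the region.**  Under the flip inequalities at every edge of the
finite set `F`, for `a(ω) = |ω ∩ F| = Σ_{e ∈ F} J_e(ω)`: `|cov_W(a, X)| ≤ |F| (Λ_hi/Λ_lo) r(1-r)` for `0 ≤ X ≤ 1` —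
Grimmett 2006, eq. (2.45) (`cov(|η|, X) = Σ_e cov(J_e, X)`) and the per-edge bound.
[cite: Grimmett2006, Thm. (2.43) eq. (2.45) p. 40] -/
theorem abs_cov_le_of_flip (F : Finset ι) {a : Set ι → ℕ} {W X : Set ι → ℝ} {Λlo Λhi r : ℝ}
    (ha : ∀ ω, (a ω : ℝ) = ∑ e ∈ F, (if e ∈ ω then (1 : ℝ) else 0)) (hW : ∀ ω, 0 ≤ W ω)
    (hZ : 0 < ∑ ω, W ω) (hX : ∀ ω, 0 ≤ X ω ∧ X ω ≤ 1) (hlo : 0 < Λlo) (hlo1 : Λlo ≤ 1) (hhi : 1 ≤ Λhi)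
    (hr : r ∈ Set.Icc (0 : ℝ) 1)
    (h1 : ∀ e ∈ F, ∀ ω : Set ι, e ∉ ω → (1 - r) * W (insert e ω) ≤ Λhi * r * W ω)
    (h2 : ∀ e ∈ F, ∀ ω : Set ι, e ∉ ω → Λlo * r * W ω ≤ (1 - r) * W (insert e ω)) :
    |(∑ ω, W ω * ((a ω : ℝ) * X ω)) / (∑ ω, W ω) -
        (∑ ω, W ω * (a ω : ℝ)) / (∑ ω, W ω) * ((∑ ω, W ω * X ω) / ∑ ω, W ω)| ≤
      #F * (Λhi / Λlo * (r * (1 - r))) := by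
  simp only [ha]
  rw [cov_sum_left F W X (fun e ω => if e ∈ ω then (1 : ℝ) else 0)]
  refine (Finset.abs_sum_le_sum_abs _ _).trans ?_
  calc ∑ e ∈ F, |(∑ ω, W ω * ((if e ∈ ω then (1 : ℝ) else 0) * X ω)) / (∑ ω, W ω) -
          (∑ ω, W ω * (if e ∈ ω then (1 : ℝ) else 0)) / (∑ ω, W ω) * ((∑ ω, W ω * X ω) / ∑ ω, W ω)|
      ≤ ∑ e ∈ F, Λhi / Λlo * (r * (1 - r)) := Finset.sum_le_sum fun e he =>
        abs_cov_indicator_le_of_flip e hW hZ hX hlo hlo1 hhi hr (h1 e he) (h2 e he)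
    _ = #F * (Λhi / Λlo * (r * (1 - r))) := by rw [Finset.sum_const, nsmul_eq_mul]

omit [Fintype ι] in
/-- The number of open edges of the region goes up by one when an edge `e ∈ F` of `ω ∌ e` is opened:
`a(ω ∪ {e}) = a(ω) + 1` for `a = Σ_{f ∈ F} J_f`. [folklore] -/
theorem exponent_insert (F : Finset ι) {a : Set ι → ℕ}
    (ha : ∀ ω, (a ω : ℝ) = ∑ e ∈ F, (if e ∈ ω then (1 : ℝ) else 0)) {e : ι} (he : e ∈ F) {ω : Set ι}
    (hω : e ∉ ω) : a (insert e ω) = a ω + 1 := by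
  -- split off the term `f = e`; the other terms do not see the state of `e`
  have key : ∀ s : Set ι,
      (a s : ℝ) = (if e ∈ s then (1 : ℝ) else 0) + ∑ f ∈ F.erase e, (if f ∈ s then (1 : ℝ) else 0) :=
    fun s => by rw [ha s, ← Finset.add_sum_erase F (fun f => if f ∈ s then (1 : ℝ) else 0) he]
  have h1 := key (insert e ω)
  have h2 := key ω
  rw [if_pos (Set.mem_insert e ω)] at h1
  rw [if_neg hω, zero_add] at h2
  -- for `f ≠ e` the indicator of `f` does not see the state of `e` (stated on the generic instances of `key`)
  have h3 : ∀ s : Set ι, s = insert e ω →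
      ∑ f ∈ F.erase e, (if f ∈ s then (1 : ℝ) else 0) = ∑ f ∈ F.erase e, (if f ∈ ω then (1 : ℝ) else 0) := by
    intro s hs
    refine Finset.sum_congr rfl fun f hf => ?_
    have hfe : f ≠ e := Finset.ne_of_mem_erase hf
    by_cases hfω : f ∈ ω
    · rw [if_pos hfω, if_pos (hs ▸ Set.mem_insert_of_mem e hfω)]
    · have hfs : f ∉ s := fun h => hfω ((Set.mem_insert_iff.1 (hs ▸ h)).resolve_left hfe)
      rw [if_neg hfω, if_neg hfs]
  have h4 : (a (insert e ω) : ℝ) = 1 + a ω := by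
    rw [h1, h2, h3 (insert e ω) rfl]
  have h5 : (a (insert e ω) : ℝ) = ((a ω + 1 : ℕ) : ℝ) := by rw [h4]; push_cast; ring
  exact_mod_cast h5

end PerEdge

/-! ### §2 The tilted family `w_r(ω) = r^{a(ω)} (1-r)^{b(ω)} μ(ω)`, `a = |ω ∩ F|`, `b = |F ∖ ω|`: margin-free bound -/

section Tilt

/-- **Upper flip inequality of the tilted weight** (Grimmett 2006, eq. (2.42)/(2.46)): with exponents `a₁ = a₀ + 1`,
`b₀ = b₁ + 1` (one more open edge) and `μ₁ ≤ Λ_hi μ₀`: `(1-r) · r^{a₁} (1-r)^{b₁} μ₁ ≤ Λ_hi r · r^{a₀} (1-r)^{b₀} μ₀`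
for `r ∈ [0, 1]` — the conditional density of the edge under the tilted weight is at most `Λ_hi r / (Λ_hi r + 1 - r)`
(random-cluster weight: `Λ_hi = 1`, density at most `p`, Grimmett 2006 Thm. (3.1) eq. (3.3)).
[cite: Grimmett2006, Thm. (3.1) eq. (3.3) p. 43; §2.5 eq. (2.42) p. 40] -/
theorem tilt_flip_le {a₀ a₁ b₀ b₁ : ℕ} {μ₀ μ₁ Λhi r : ℝ} (ha : a₁ = a₀ + 1) (hb : b₀ = b₁ + 1)
    (hr : r ∈ Set.Icc (0 : ℝ) 1) (hup : μ₁ ≤ Λhi * μ₀) :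
    (1 - r) * (r ^ a₁ * (1 - r) ^ b₁ * μ₁) ≤ Λhi * r * (r ^ a₀ * (1 - r) ^ b₀ * μ₀) := by
  subst ha hb
  rw [pow_succ, pow_succ]
  have hr0 : 0 ≤ r := hr.1
  have hr1 : 0 ≤ 1 - r := sub_nonneg.2 hr.2
  have hc : 0 ≤ r ^ a₀ * r * ((1 - r) ^ b₁ * (1 - r)) := by positivity
  have key := mul_le_mul_of_nonneg_left hup hc
  nlinarith [key]

/-- **Lower flip inequality of the tilted weight**: with `a₁ = a₀ + 1`, `b₀ = b₁ + 1` and `Λ_lo μ₀ ≤ μ₁`: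
`Λ_lo r · r^{a₀} (1-r)^{b₀} μ₀ ≤ (1-r) · r^{a₁} (1-r)^{b₁} μ₁` (`r ∈ [0, 1]`) — the conditional density of the edge is
at least `Λ_lo r / (Λ_lo r + 1 - r)` (random-cluster weight, `q ≥ 1`: `Λ_lo = q⁻¹`, density at least `p/(p + q(1-p))`,
Grimmett 2006 Thm. (3.1) eq. (3.3)). [cite: Grimmett2006, Thm. (3.1) eq. (3.3) p. 43; §2.5 eq. (2.42) p. 40] -/
theorem le_tilt_flip {a₀ a₁ b₀ b₁ : ℕ} {μ₀ μ₁ Λlo r : ℝ} (ha : a₁ = a₀ + 1) (hb : b₀ = b₁ + 1)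
    (hr : r ∈ Set.Icc (0 : ℝ) 1) (hdn : Λlo * μ₀ ≤ μ₁) :
    Λlo * r * (r ^ a₀ * (1 - r) ^ b₀ * μ₀) ≤ (1 - r) * (r ^ a₁ * (1 - r) ^ b₁ * μ₁) := by
  subst ha hb
  rw [pow_succ, pow_succ]
  have hr0 : 0 ≤ r := hr.1
  have hr1 : 0 ≤ 1 - r := sub_nonneg.2 hr.2
  have hc : 0 ≤ r ^ a₀ * r * ((1 - r) ^ b₁ * (1 - r)) := by positivity
  have key := mul_le_mul_of_nonneg_left hdn hc
  nlinarith [key]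

open scoped Classical

variable {ι : Type*} [Fintype ι]

/-- **The margin-free Lipschitz bound for tilted measures with one-edge finite energy** (Grimmett 2006, Thm. (2.43)
with eq. (2.45), and the mean value theorem).  Let `μ ≥ 0` on `Set ι`, not identically zero, satisfy
`Λ_lo μ(ω) ≤ μ(ω ∪ {e}) ≤ Λ_hi μ(ω)` for every `e ∈ F`, `ω ∌ e` (`0 < Λ_lo ≤ 1 ≤ Λ_hi`), let `a(ω) = |ω ∩ F| = Σ_{e∈F} J_e(ω)`,
`b(ω) = |F| - a(ω)`, and `E_r[X] = (Σ_ω w_r(ω) X(ω)) / Σ_ω w_r(ω)` with `w_r(ω) = r^{a(ω)} (1-r)^{b(ω)} μ(ω)`.  Then for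
every `0 ≤ X ≤ 1` and `p, p' ∈ (0, 1)`: `|E_{p'}[X] - E_p[X]| ≤ (Λ_hi/Λ_lo) |F| |p' - p|` — the derivative is
`cov_r(a, X)/(r(1-r)) = Σ_{e ∈ F} cov_r(J_e, X)/(r(1-r))` and each `|cov_r(J_e, X)| ≤ (Λ_hi/Λ_lo) r(1-r)`.
Uniform in `μ`, hence in any boundary condition / frozen environment encoded in `μ`.
[cite: Grimmett2006, Thm. (2.43) eq. (2.44)–(2.45) p. 40; Thm. (3.1) eq. (3.3) p. 43] -/
theorem abs_tiltAvg_sub_tiltAvg_le_mul (F : Finset ι) {a b : Set ι → ℕ} {μ : Set ι → ℝ} {Λlo Λhi : ℝ}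
    (X : Set ι → ℝ) (ha : ∀ ω, (a ω : ℝ) = ∑ e ∈ F, (if e ∈ ω then (1 : ℝ) else 0))
    (hab : ∀ ω, a ω + b ω = #F) (hμ : ∀ ω, 0 ≤ μ ω) (hμ0 : ∃ ω, 0 < μ ω) (hX : ∀ ω, 0 ≤ X ω ∧ X ω ≤ 1)
    (hlo : 0 < Λlo) (hlo1 : Λlo ≤ 1) (hhi : 1 ≤ Λhi)
    (hup : ∀ e ∈ F, ∀ ω : Set ι, e ∉ ω → μ (insert e ω) ≤ Λhi * μ ω)
    (hdn : ∀ e ∈ F, ∀ ω : Set ι, e ∉ ω → Λlo * μ ω ≤ μ (insert e ω)) {p p' : ℝ}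
    (hp : p ∈ Set.Ioo (0 : ℝ) 1) (hp' : p' ∈ Set.Ioo (0 : ℝ) 1) :
    |(∑ ω, p' ^ a ω * (1 - p') ^ b ω * μ ω * X ω) / (∑ ω, p' ^ a ω * (1 - p') ^ b ω * μ ω) -
        (∑ ω, p ^ a ω * (1 - p) ^ b ω * μ ω * X ω) / (∑ ω, p ^ a ω * (1 - p) ^ b ω * μ ω)| ≤
      Λhi / Λlo * #F * |p' - p| := by
  have hμ' : ∀ ω ∈ (univ : Finset (Set ι)), 0 ≤ μ ω := fun ω _ => hμ ω
  have hμ0' : ∃ ω ∈ (univ : Finset (Set ι)), 0 < μ ω := by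
    obtain ⟨ω₀, h⟩ := hμ0
    exact ⟨ω₀, Finset.mem_univ _, h⟩
  -- exponent bookkeeping when one edge of `F` is opened
  have ha1 : ∀ e ∈ F, ∀ ω : Set ι, e ∉ ω → a (insert e ω) = a ω + 1 :=
    fun e he ω hω => exponent_insert F ha he hω
  have hb1 : ∀ e ∈ F, ∀ ω : Set ι, e ∉ ω → b ω = b (insert e ω) + 1 := by
    intro e he ω hω
    have h1 := hab ω
    have h2 := hab (insert e ω)
    have h3 := ha1 e he ω hω
    omega
  -- the segment `[p, p']` lies inside `(0, 1)`
  have hseg : ∀ r ∈ Set.uIcc p p', r ∈ Set.Ioo (0 : ℝ) 1 := by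
    intro r hr
    rcases Set.mem_uIcc.1 hr with ⟨h1, h2⟩ | ⟨h1, h2⟩
    · exact ⟨hp.1.trans_le h1, h2.trans_lt hp'.2⟩
    · exact ⟨hp'.1.trans_le h1, h2.trans_lt hp.2⟩
  -- the function, its derivative (covariance form) and the derivative bound on the segment
  set f : ℝ → ℝ := fun r => (∑ ω, r ^ a ω * (1 - r) ^ b ω * μ ω * X ω) /
    ∑ ω, r ^ a ω * (1 - r) ^ b ω * μ ω with hf
  set w : ℝ → Set ι → ℝ := fun r ω => r ^ a ω * (1 - r) ^ b ω * μ ω with hw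
  set ℓ : ℝ → Set ι → ℝ := fun r ω => (a ω : ℝ) / r - (b ω : ℝ) / (1 - r) with hℓ
  set f' : ℝ → ℝ := fun r => (∑ ω, w r ω * (ℓ r ω * X ω)) / (∑ ω, w r ω) -
    (∑ ω, w r ω * ℓ r ω) / (∑ ω, w r ω) * ((∑ ω, w r ω * X ω) / ∑ ω, w r ω) with hf'
  have hderiv : ∀ r ∈ Set.uIcc p p', HasDerivWithinAt f (f' r) (Set.uIcc p p') r := by
    intro r hr
    have hr' := hseg r hr
    have hZ : ∑ ω, w r ω ≠ 0 := (sum_tilt_pos univ a b hμ' hμ0' hr').ne'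
    exact (hasDerivAt_sum_mul_div_sum univ (w := w) (ℓ := ℓ r) X
      (fun ω _ => hasDerivAt_pow_mul_one_sub_pow_mul (a ω) (b ω) (μ ω) hr'.1.ne' hr'.2.ne) hZ).hasDerivWithinAt
  have hbound : ∀ r ∈ Set.uIcc p p', ‖f' r‖ ≤ Λhi / Λlo * #F := by
    intro r hr
    have hr' := hseg r hr
    have hr0 : r ≠ 0 := hr'.1.ne'
    have h1r : (0 : ℝ) < 1 - r := sub_pos.2 hr'.2
    have h1r0 : (1 : ℝ) - r ≠ 0 := h1r.ne'
    have hrI : r ∈ Set.Icc (0 : ℝ) 1 := ⟨hr'.1.le, hr'.2.le⟩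
    have hZpos : 0 < ∑ ω, w r ω := sum_tilt_pos univ a b hμ' hμ0' hr'
    have hZ : ∑ ω, w r ω ≠ 0 := hZpos.ne'
    have hwnn : ∀ ω, 0 ≤ w r ω := fun ω =>
      mul_nonneg (mul_nonneg (pow_nonneg hr'.1.le _) (pow_nonneg h1r.le _)) (hμ ω)
    -- `ℓ_r = a/(r(1-r)) - |F|/(1-r)` is affine in `a`
    have haff : ∀ ω ∈ (univ : Finset (Set ι)), ℓ r ω = 1 / (r * (1 - r)) * (a ω : ℝ) + -((#F : ℝ) / (1 - r)) := by
      intro ω _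
      have habω : (a ω : ℝ) + (b ω : ℝ) = (#F : ℝ) := by exact_mod_cast hab ω
      simp only [hℓ]
      rw [show (b ω : ℝ) = (#F : ℝ) - (a ω : ℝ) by linarith]
      field_simp
      ring
    have hcov : f' r = 1 / (r * (1 - r)) *
        ((∑ ω, w r ω * ((a ω : ℝ) * X ω)) / (∑ ω, w r ω) -
          (∑ ω, w r ω * (a ω : ℝ)) / (∑ ω, w r ω) * ((∑ ω, w r ω * X ω) / ∑ ω, w r ω)) :=
      cov_eq_mul_cov_of_affine univ (ℓ := fun ω => (a ω : ℝ)) (ℓ' := ℓ r) X hZ haff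
    -- the flip inequalities for `w_r`, from those of `μ`
    have H1 : ∀ e ∈ F, ∀ ω : Set ι, e ∉ ω → (1 - r) * w r (insert e ω) ≤ Λhi * r * w r ω :=
      fun e he ω hω => tilt_flip_le (ha1 e he ω hω) (hb1 e he ω hω) hrI (hup e he ω hω)
    have H2 : ∀ e ∈ F, ∀ ω : Set ι, e ∉ ω → Λlo * r * w r ω ≤ (1 - r) * w r (insert e ω) :=
      fun e he ω hω => le_tilt_flip (ha1 e he ω hω) (hb1 e he ω hω) hrI (hdn e he ω hω)
    have key := abs_cov_le_of_flip F ha hwnn hZpos hX hlo hlo1 hhi hrI H1 H2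
    have hc : 0 < 1 / (r * (1 - r)) := one_div_pos.2 (mul_pos hr'.1 h1r)
    rw [Real.norm_eq_abs, hcov, abs_mul, abs_of_pos hc]
    calc 1 / (r * (1 - r)) *
          |(∑ ω, w r ω * ((a ω : ℝ) * X ω)) / (∑ ω, w r ω) -
            (∑ ω, w r ω * (a ω : ℝ)) / (∑ ω, w r ω) * ((∑ ω, w r ω * X ω) / ∑ ω, w r ω)|
        ≤ 1 / (r * (1 - r)) * (#F * (Λhi / Λlo * (r * (1 - r)))) := mul_le_mul_of_nonneg_left key hc.le
      _ = Λhi / Λlo * #F := by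
        field_simp
  have := (convex_uIcc p p').norm_image_sub_le_of_norm_hasDerivWithin_le hderiv hbound
    Set.left_mem_uIcc Set.right_mem_uIcc
  simpa only [Real.norm_eq_abs, hf] using this

end Tilt

end FK

end Summit.CriticalPhenomena.PercolationContinuityZ3.Theorems

end
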